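import Mathlib
import HarnessLib
import Summits.HubbardSuperconductivity.HubbardSuperconductivity.Theorems.KLProgrammeKLRegimeFlowReadScaleZeroDiagonalSplit

/-!
# Route `KLProgramme`, crux K3 — gen-8 ENGINE-FLOW child (stmt-HubbardSuperconductivity-20437 `KLRegimeEngineV17F2`), stub (C) at `n = 0`,
# located item #22a «(C)-SCALE0-PT2», step (π4): THE THREE-PIECE SPLIT OF RECORD OF THE SCALE-`0` OUTPUT —
# `W₀ = T₃ + (S + Q_c + D_e)` AT THE LEVEL OF TWO-LEG KERNELS, with `S` the EXPLICIT off-diagonal sunset quadratic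

Seat hubbard-kl-k3c5-p1 (g14; owner of #22a).  With π1b (p610302 `kernel_two_scaleZero_effAction_offDiag`), π3a (p618339 `…_diag`), the chain `Q_c`
(π2b p613532) and the diagonal quadratic `D_e` (π3b-ii p619685), the two-leg kernel of the scale-`0` grid output `W₀ = effAction (S_{4M}ᵀC⁰_{>e₀}S_{4M}) V_{4M}`
is, entry by entry, `kernel₂ T₃ + kernel₂ S + kernel₂ Q_c + kernel₂ D_e` where `T₃ = W₀ − e^{Δ}V + ½(e^{Δ}V² − (e^{Δ}V)²)` is the order-`≥ 3` remainder
(p1's TAIL DOORS `…ScaleZeroTwoLegTail3*`) and **`S := Σ_{p',q',σ'} s(p',q',σ') • ψ⁺_{p'σ'}ψ⁻_{q'σ'}`**,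
`s(p',q',σ') = [p' ≠ q']·(−(Uε)²·A((q',σ')⁺,(p',σ')⁻)·A((p',σ̄')⁺,(q',σ̄')⁻)·A((q',σ̄')⁺,(p',σ̄')⁻))` (`ε = β/4M`, `A = contr (S_{4M}ᵀC⁰_{>e₀}S_{4M})`) is the
off-diagonal SUNSET as a grid Grassmann element of its own.  This file (no definition; `S`, `Q_c`, `D_e`, `T₃` written out):

* §1 `kernel_two_pairQuadratic` — `kernel₂ (Σ f(p',q',σ')•ψ⁺_{p'σ'}ψ⁻_{q'σ'}) ((p,σ,+),(q,σ,−)) = ½·f(p,q,σ)` for ANY coefficient function (the chain's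
  `kernel_two_chainQuadratic` and the sunset's kernel are instances);
* §2 **`kernel_two_scaleZero_effAction_sub_sunset_chain_diag`** — for EVERY pair of grid points (coincident or not) and every spin,
  `kernel₂ (W₀ − S − Q_c − D_e) ((p,σ,+),(q,σ,−)) = kernel₂ T₃ ((p,σ,+),(q,σ,−))`: the element `W_a″ := W₀ − (S + Q_c + D_e)` of the MIXED door
  (k3c3-p1 p608958 `twoLegRead_frameZero_of_split_certD`, `W₀ = W_a″ + W_b″`) carries ONLY the tail in its two-leg kernel, so p1's tail rows
  (`twoLeg_wsum_tail3_frameZero_le_booked`, `twoLeg_offDiag_moment_pow_sum_tail3_frameZero_le_booked`) ARE its rows `(a-on)/(a-off)` — §3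
  `sum_weight_norm_kernel_two_scaleZero_sub_sunset_chain_diag_eq` (any pair weight);
* §4 **`sum_weight_norm_kernel_two_sunsetQuadratic_eq`** — the sunset's weighted pinned sums in COVARIANCE currency:
  `Σ_{p₁} w(p₀,p₁)‖kernel₂ S ((p₀,σ,+),(p₁,σ,−))‖ = ½(Uε)²·Σ_{p₁}[p₁ ≠ p₀] w(p₀,p₁)·‖A A A‖` — the shape in which the certified tables `bS₀, bS₁, bS₂ᴱ`
  (SCALE0-PT2-CERT-SPEC v2 §0; kit) and the β/L/M layers (p1 g19 D3–D7, this lineage's (β1)) deliver the momentum-side piece `W_b″ ⊇ S`.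

Proofs only; no definitions; nothing asserts any stub of 20437, K3 or superconductivity.
References: BGM 2006 §2.1 (2.3)–(2.6), §2.2 (2.13)–(2.14) [cite: BenfattoGiulianiMastropietro2006]; Salmhofer 1999 §4.3 (4.95) [cite: Salmhofer1999].
-/

noncomputable section

namespace Summit.HubbardSuperconductivity.HubbardSuperconductivity.Theorems.KLRegimeSplit

set_option linter.dupNamespace false -- summit = problem name (single-conjunct summit), D-0017

open Real Finset Complex Literature.MathematicalPhysics.QuantumLattice Literature.Probability.LatticeModels GrassmannAlgebra Matrix
open Summit.HubbardSuperconductivity.HubbardSuperconductivity.Theorems.EngineV8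

/-! ## §1 The two-leg kernel of a general pair quadratic -/

section Pair

variable {L N : ℕ} [NeZero L]

/-- **`kernel₂ (Σ_{p',q',σ'} f(p',q',σ')•ψ⁺_{p'σ'}ψ⁻_{q'σ'}) ((p,σ,+),(q,σ,−)) = ½·f(p,q,σ)`** for any coefficient function `f`. -/
theorem kernel_two_pairQuadratic (f : GridPoint L N → GridPoint L N → Fin 2 → ℂ) (p q : GridPoint L N) (σ : Fin 2) :
    kernel ℂ (∑ p' : GridPoint L N, ∑ q' : GridPoint L N, ∑ σ' : Fin 2,
          f p' q' σ' • (gen ℂ (((p', σ'), 0) : GridLeg (GridPoint L N)) * gen ℂ (((q', σ'), 1) : GridLeg (GridPoint L N))))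
        2 (fun i => ((![p, q] i, σ), i)) = (2 : ℂ)⁻¹ * f p q σ := by
  rw [twoLegString_eq]
  simp only [kernel_sum, kernel_smul, kernel_two_gen_mul_gen, Matrix.cons_val_zero, Matrix.cons_val_one, Prod.mk.injEq, and_true,
    zero_ne_one, and_false, if_false, one_ne_zero, mul_zero, sub_zero]
  rw [Finset.sum_eq_single_of_mem p (Finset.mem_univ _) (fun p' _ hp' => by
        have h : ¬p = p' := fun h => hp' h.symm
        simp only [h, false_and, if_false, zero_mul, mul_zero, Finset.sum_const_zero]),
    Finset.sum_eq_single_of_mem q (Finset.mem_univ _) (fun q' _ hq' => by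
        have h : ¬q = q' := fun h => hq' h.symm
        simp only [h, false_and, if_false, mul_zero, Finset.sum_const_zero]),
    Finset.sum_eq_single_of_mem σ (Finset.mem_univ _) (fun σ' _ hσ' => by
        have h : ¬σ = σ' := fun h => hσ' h.symm
        simp only [h, and_false, if_false, mul_zero])]
  simp only [and_self, if_true, mul_one]
  ring

end Pair

/-! ## §2 The split of record at the level of two-leg kernels -/

section Split

variable {L M : ℕ} [NeZero L] [NeZero M]

omit [NeZero M] in
/-- **`kernel₂ S ((p,σ,+),(q,σ,−)) = [p ≠ q]·(−½(Uε)²·A((q,σ)⁺,(p,σ)⁻)·A((p,σ̄)⁺,(q,σ̄)⁻)·A((q,σ̄)⁺,(p,σ̄)⁻))`** — the off-diagonal sunset quadratic's kernel. -/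
theorem kernel_two_sunsetQuadratic (β U μ : ℝ) (p q : GridPoint L (2 * (2 * M))) (σ : Fin 2) :
    kernel ℂ (∑ p' : GridPoint L (2 * (2 * M)), ∑ q' : GridPoint L (2 * (2 * M)), ∑ σ' : Fin 2,
          (if p' = q' then (0 : ℂ) else
            -((((U * (β / (2 * (2 * M) : ℕ)) : ℝ) : ℂ) ^ 2 *
              (contr ℂ ((hubbardGridSub L M β (2 * (2 * M))).transpose * hubbardCovAboveCT L M β μ 0 0 klE0 *
                  hubbardGridSub L M β (2 * (2 * M))) (((q', σ'), 0) : GridLeg (GridPoint L (2 * (2 * M)))) ((p', σ'), 1) *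
                (contr ℂ ((hubbardGridSub L M β (2 * (2 * M))).transpose * hubbardCovAboveCT L M β μ 0 0 klE0 *
                    hubbardGridSub L M β (2 * (2 * M))) (((p', σ'.rev), 0) : GridLeg (GridPoint L (2 * (2 * M)))) ((q', σ'.rev), 1) *
                  contr ℂ ((hubbardGridSub L M β (2 * (2 * M))).transpose * hubbardCovAboveCT L M β μ 0 0 klE0 *
                    hubbardGridSub L M β (2 * (2 * M))) (((q', σ'.rev), 0) : GridLeg (GridPoint L (2 * (2 * M)))) ((p', σ'.rev), 1)))))) •
            (gen ℂ (((p', σ'), 0) : GridLeg (GridPoint L (2 * (2 * M)))) * gen ℂ (((q', σ'), 1) : GridLeg (GridPoint L (2 * (2 * M))))))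
        2 (fun i => ((![p, q] i, σ), i)) =
      if p = q then (0 : ℂ) else
        -(2 : ℂ)⁻¹ * (((U * (β / (2 * (2 * M) : ℕ)) : ℝ) : ℂ) ^ 2 *
          (contr ℂ ((hubbardGridSub L M β (2 * (2 * M))).transpose * hubbardCovAboveCT L M β μ 0 0 klE0 *
              hubbardGridSub L M β (2 * (2 * M))) (((q, σ), 0) : GridLeg (GridPoint L (2 * (2 * M)))) ((p, σ), 1) *
            (contr ℂ ((hubbardGridSub L M β (2 * (2 * M))).transpose * hubbardCovAboveCT L M β μ 0 0 klE0 *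
                hubbardGridSub L M β (2 * (2 * M))) (((p, σ.rev), 0) : GridLeg (GridPoint L (2 * (2 * M)))) ((q, σ.rev), 1) *
              contr ℂ ((hubbardGridSub L M β (2 * (2 * M))).transpose * hubbardCovAboveCT L M β μ 0 0 klE0 *
                hubbardGridSub L M β (2 * (2 * M))) (((q, σ.rev), 0) : GridLeg (GridPoint L (2 * (2 * M)))) ((p, σ.rev), 1)))) := by
  rw [kernel_two_pairQuadratic]
  split_ifs <;> ring

/-- **THE SPLIT OF RECORD AT THE LEVEL OF TWO-LEG KERNELS**: with `S` the off-diagonal sunset quadratic, `Q_c` the chain (`c = (Uε)²t₀²`) and `D_e` the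
diagonal quadratic of record, for EVERY pair of grid points `p, q` and every spin,
`kernel₂ (W₀ − S − Q_c − D_e) ((p,σ,+),(q,σ,−)) = kernel₂ (W₀ − e^{Δ}V + ½(e^{Δ}V² − (e^{Δ}V)²)) ((p,σ,+),(q,σ,−))`. -/
theorem kernel_two_scaleZero_effAction_sub_sunset_chain_diag (β U μ : ℝ) (p q : GridPoint L (2 * (2 * M))) (σ : Fin 2) :
    kernel ℂ (effAction ℂ ((hubbardGridSub L M β (2 * (2 * M))).transpose * hubbardCovAboveCT L M β μ 0 0 klE0 *
          hubbardGridSub L M β (2 * (2 * M))) (hubbardGridInteraction L (2 * (2 * M)) β U) -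
        (∑ p' : GridPoint L (2 * (2 * M)), ∑ q' : GridPoint L (2 * (2 * M)), ∑ σ' : Fin 2,
          (if p' = q' then (0 : ℂ) else
            -((((U * (β / (2 * (2 * M) : ℕ)) : ℝ) : ℂ) ^ 2 *
              (contr ℂ ((hubbardGridSub L M β (2 * (2 * M))).transpose * hubbardCovAboveCT L M β μ 0 0 klE0 *
                  hubbardGridSub L M β (2 * (2 * M))) (((q', σ'), 0) : GridLeg (GridPoint L (2 * (2 * M)))) ((p', σ'), 1) *
                (contr ℂ ((hubbardGridSub L M β (2 * (2 * M))).transpose * hubbardCovAboveCT L M β μ 0 0 klE0 *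
                    hubbardGridSub L M β (2 * (2 * M))) (((p', σ'.rev), 0) : GridLeg (GridPoint L (2 * (2 * M)))) ((q', σ'.rev), 1) *
                  contr ℂ ((hubbardGridSub L M β (2 * (2 * M))).transpose * hubbardCovAboveCT L M β μ 0 0 klE0 *
                    hubbardGridSub L M β (2 * (2 * M))) (((q', σ'.rev), 0) : GridLeg (GridPoint L (2 * (2 * M)))) ((p', σ'.rev), 1)))))) •
            (gen ℂ (((p', σ'), 0) : GridLeg (GridPoint L (2 * (2 * M)))) * gen ℂ (((q', σ'), 1) : GridLeg (GridPoint L (2 * (2 * M)))))) -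
        (∑ p' : GridPoint L (2 * (2 * M)), ∑ q' : GridPoint L (2 * (2 * M)), ∑ σ' : Fin 2,
          ((((U * (β / (2 * (2 * M) : ℕ)) : ℝ) : ℂ) ^ 2 *
              ((-∑ k : FreqMomentum L M, ((1 / (β * (L : ℝ) ^ 2) : ℝ) : ℂ) ^ 2 * uvSymbolCT L M β μ 0 klE0 (k, 0)) *
               (-∑ k : FreqMomentum L M, ((1 / (β * (L : ℝ) ^ 2) : ℝ) : ℂ) ^ 2 * uvSymbolCT L M β μ 0 klE0 (k, 0)))) *
            contr ℂ ((hubbardGridSub L M β (2 * (2 * M))).transpose * hubbardCovAboveCT L M β μ 0 0 klE0 *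
              hubbardGridSub L M β (2 * (2 * M))) (((q', σ'), 0) : GridLeg (GridPoint L (2 * (2 * M)))) ((p', σ'), 1)) •
            (gen ℂ (((p', σ'), 0) : GridLeg (GridPoint L (2 * (2 * M)))) * gen ℂ (((q', σ'), 1) : GridLeg (GridPoint L (2 * (2 * M)))))) -
        (∑ p' : GridPoint L (2 * (2 * M)), ∑ σ' : Fin 2,
          ((2 : ℂ) * ((2 : ℂ)⁻¹ * (((U * (β / (2 * (2 * M) : ℕ)) : ℝ) : ℂ) *
              (-∑ k : FreqMomentum L M, ((1 / (β * (L : ℝ) ^ 2) : ℝ) : ℂ) ^ 2 * uvSymbolCT L M β μ 0 klE0 (k, 0))) +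
            (2 : ℂ)⁻¹ * (((U * (β / (2 * (2 * M) : ℕ)) : ℝ) : ℂ) ^ 2 *
              ((-∑ k : FreqMomentum L M, ((1 / (β * (L : ℝ) ^ 2) : ℝ) : ℂ) ^ 2 * uvSymbolCT L M β μ 0 klE0 (k, 0)) *
                ∑ q : GridPoint L (2 * (2 * M)),
                  contr ℂ ((hubbardGridSub L M β (2 * (2 * M))).transpose * hubbardCovAboveCT L M β μ 0 0 klE0 *
                      hubbardGridSub L M β (2 * (2 * M))) (((p', σ'.rev), 0) : GridLeg (GridPoint L (2 * (2 * M)))) ((q, σ'.rev), 1) *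
                    contr ℂ ((hubbardGridSub L M β (2 * (2 * M))).transpose * hubbardCovAboveCT L M β μ 0 0 klE0 *
                      hubbardGridSub L M β (2 * (2 * M))) (((q, σ'.rev), 0) : GridLeg (GridPoint L (2 * (2 * M)))) ((p', σ'.rev), 1))) -
            (2 : ℂ)⁻¹ * ((((U * (β / (2 * (2 * M) : ℕ)) : ℝ) : ℂ) ^ 2 *
                ((-∑ k : FreqMomentum L M, ((1 / (β * (L : ℝ) ^ 2) : ℝ) : ℂ) ^ 2 * uvSymbolCT L M β μ 0 klE0 (k, 0)) *
                 (-∑ k : FreqMomentum L M, ((1 / (β * (L : ℝ) ^ 2) : ℝ) : ℂ) ^ 2 * uvSymbolCT L M β μ 0 klE0 (k, 0)))) *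
              (-∑ k : FreqMomentum L M, ((1 / (β * (L : ℝ) ^ 2) : ℝ) : ℂ) ^ 2 * uvSymbolCT L M β μ 0 klE0 (k, 0))))) •
            (gen ℂ (((p', σ'), 0) : GridLeg (GridPoint L (2 * (2 * M)))) * gen ℂ (((p', σ'), 1) : GridLeg (GridPoint L (2 * (2 * M))))))) 2
        (fun i => ((![p, q] i, σ), i)) =
      kernel ℂ (effAction ℂ ((hubbardGridSub L M β (2 * (2 * M))).transpose * hubbardCovAboveCT L M β μ 0 0 klE0 *
            hubbardGridSub L M β (2 * (2 * M))) (hubbardGridInteraction L (2 * (2 * M)) β U) -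
          gaussConv ℂ ((hubbardGridSub L M β (2 * (2 * M))).transpose * hubbardCovAboveCT L M β μ 0 0 klE0 *
            hubbardGridSub L M β (2 * (2 * M))) (hubbardGridInteraction L (2 * (2 * M)) β U) +
        (2 : ℂ)⁻¹ • (gaussConv ℂ ((hubbardGridSub L M β (2 * (2 * M))).transpose * hubbardCovAboveCT L M β μ 0 0 klE0 *
              hubbardGridSub L M β (2 * (2 * M))) (hubbardGridInteraction L (2 * (2 * M)) β U * hubbardGridInteraction L (2 * (2 * M)) β U) -
          gaussConv ℂ ((hubbardGridSub L M β (2 * (2 * M))).transpose * hubbardCovAboveCT L M β μ 0 0 klE0 *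
              hubbardGridSub L M β (2 * (2 * M))) (hubbardGridInteraction L (2 * (2 * M)) β U) *
            gaussConv ℂ ((hubbardGridSub L M β (2 * (2 * M))).transpose * hubbardCovAboveCT L M β μ 0 0 klE0 *
              hubbardGridSub L M β (2 * (2 * M))) (hubbardGridInteraction L (2 * (2 * M)) β U))) 2
        (fun i => ((![p, q] i, σ), i)) := by
  by_cases hpq : p = q
  · subst hpq
    rw [kernel_sub_apply, kernel_sub_apply, kernel_sub_apply, kernel_two_scaleZero_effAction_diag β U μ p σ, kernel_two_sunsetQuadratic,
      if_pos rfl, kernel_two_chainQuadratic β μ _ p p σ, kernel_two_diagQuadratic, if_pos rfl, contr_scaleZeroGridCov_samePoint β μ p σ]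
    ring
  · rw [kernel_sub_apply, kernel_sub_apply, kernel_sub_apply, kernel_two_scaleZero_effAction_offDiag β U μ p q hpq σ,
      kernel_two_sunsetQuadratic, if_neg hpq, kernel_two_chainQuadratic β μ _ p q σ, kernel_two_diagQuadratic, if_neg (Ne.symm hpq)]
    ring

/-! ## §3 The sunset's pinned sums in covariance currency -/

omit [NeZero M] in
/-- **The sunset quadratic's weighted pinned sums are covariance sums**: for any pair weight `w`, pin `p₀` and spin `σ`,
`Σ_{p₁} w(p₀,p₁)·‖kernel₂ S ((p₀,σ,+),(p₁,σ,−))‖ = ½(Uε)²·Σ_{p₁}[p₁ ≠ p₀] w(p₀,p₁)·‖A((p₁,σ)⁺,(p₀,σ)⁻)·A((p₀,σ̄)⁺,(p₁,σ̄)⁻)·A((p₁,σ̄)⁺,(p₀,σ̄)⁻)‖`. -/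
theorem sum_weight_norm_kernel_two_sunsetQuadratic_eq (β U μ : ℝ) (w : GridPoint L (2 * (2 * M)) → GridPoint L (2 * (2 * M)) → ℝ)
    (σ : Fin 2) (p₀ : GridPoint L (2 * (2 * M))) :
    ∑ p₁ : GridPoint L (2 * (2 * M)), w p₀ p₁ * ‖kernel ℂ (∑ p' : GridPoint L (2 * (2 * M)), ∑ q' : GridPoint L (2 * (2 * M)), ∑ σ' : Fin 2,
          (if p' = q' then (0 : ℂ) else
            -((((U * (β / (2 * (2 * M) : ℕ)) : ℝ) : ℂ) ^ 2 *
              (contr ℂ ((hubbardGridSub L M β (2 * (2 * M))).transpose * hubbardCovAboveCT L M β μ 0 0 klE0 *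
                  hubbardGridSub L M β (2 * (2 * M))) (((q', σ'), 0) : GridLeg (GridPoint L (2 * (2 * M)))) ((p', σ'), 1) *
                (contr ℂ ((hubbardGridSub L M β (2 * (2 * M))).transpose * hubbardCovAboveCT L M β μ 0 0 klE0 *
                    hubbardGridSub L M β (2 * (2 * M))) (((p', σ'.rev), 0) : GridLeg (GridPoint L (2 * (2 * M)))) ((q', σ'.rev), 1) *
                  contr ℂ ((hubbardGridSub L M β (2 * (2 * M))).transpose * hubbardCovAboveCT L M β μ 0 0 klE0 *
                    hubbardGridSub L M β (2 * (2 * M))) (((q', σ'.rev), 0) : GridLeg (GridPoint L (2 * (2 * M)))) ((p', σ'.rev), 1)))))) •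
            (gen ℂ (((p', σ'), 0) : GridLeg (GridPoint L (2 * (2 * M)))) * gen ℂ (((q', σ'), 1) : GridLeg (GridPoint L (2 * (2 * M))))))
        2 (fun i => ((![p₀, p₁] i, σ), i))‖ =
      (1 / 2) * (U * (β / ((2 * (2 * M) : ℕ) : ℝ))) ^ 2 *
        ∑ p₁ : GridPoint L (2 * (2 * M)), (if p₁ = p₀ then (0 : ℝ) else w p₀ p₁ *
          ‖contr ℂ ((hubbardGridSub L M β (2 * (2 * M))).transpose * hubbardCovAboveCT L M β μ 0 0 klE0 *
                hubbardGridSub L M β (2 * (2 * M))) (((p₁, σ), 0) : GridLeg (GridPoint L (2 * (2 * M)))) ((p₀, σ), 1) *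
              (contr ℂ ((hubbardGridSub L M β (2 * (2 * M))).transpose * hubbardCovAboveCT L M β μ 0 0 klE0 *
                  hubbardGridSub L M β (2 * (2 * M))) (((p₀, σ.rev), 0) : GridLeg (GridPoint L (2 * (2 * M)))) ((p₁, σ.rev), 1) *
                contr ℂ ((hubbardGridSub L M β (2 * (2 * M))).transpose * hubbardCovAboveCT L M β μ 0 0 klE0 *
                  hubbardGridSub L M β (2 * (2 * M))) (((p₁, σ.rev), 0) : GridLeg (GridPoint L (2 * (2 * M)))) ((p₀, σ.rev), 1))‖) := by
  rw [Finset.mul_sum]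
  refine Finset.sum_congr rfl fun p₁ _ => ?_
  rw [kernel_two_sunsetQuadratic]
  by_cases h : p₀ = p₁
  · subst h; simp
  · rw [if_neg h, if_neg (Ne.symm h), norm_mul, norm_mul, norm_neg, norm_inv, Complex.norm_two, norm_pow, Complex.norm_real, Real.norm_eq_abs,
      sq_abs]
    ring

/-- **THE SUNSET'S DOOR ROWS FROM CERTIFIED COVARIANCE SUMS** (`0 < β`): if the `[p₁ ≠ p₀]`-restricted weighted covariance sum is
`≤ B·(4M/β)` (the shape the β/L/M layers deliver from the certified tables — per site `x⃗`, `Σ_j |C(x⃗,τ_j)|²|C(−x⃗,−τ_j)| = (4M/β)·Σ_j ε|C|²|C̄|`),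
then `Σ_{p₁} w(p₀,p₁)·‖kernel₂ S‖ ≤ ½·B·U²·(β/4M)` — the `b·U²·β/4M` shape of the MIXED / SIZES doors' pinned-sum rows with `b = ½B` (`c_s = ½`). -/
theorem sum_weight_norm_kernel_two_sunsetQuadratic_le {β : ℝ} (hβ : 0 < β) (U μ : ℝ)
    (w : GridPoint L (2 * (2 * M)) → GridPoint L (2 * (2 * M)) → ℝ) (σ : Fin 2) (p₀ : GridPoint L (2 * (2 * M))) {B : ℝ}
    (hB : ∑ p₁ : GridPoint L (2 * (2 * M)), (if p₁ = p₀ then (0 : ℝ) else w p₀ p₁ *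
          ‖contr ℂ ((hubbardGridSub L M β (2 * (2 * M))).transpose * hubbardCovAboveCT L M β μ 0 0 klE0 *
                hubbardGridSub L M β (2 * (2 * M))) (((p₁, σ), 0) : GridLeg (GridPoint L (2 * (2 * M)))) ((p₀, σ), 1) *
              (contr ℂ ((hubbardGridSub L M β (2 * (2 * M))).transpose * hubbardCovAboveCT L M β μ 0 0 klE0 *
                  hubbardGridSub L M β (2 * (2 * M))) (((p₀, σ.rev), 0) : GridLeg (GridPoint L (2 * (2 * M)))) ((p₁, σ.rev), 1) *
                contr ℂ ((hubbardGridSub L M β (2 * (2 * M))).transpose * hubbardCovAboveCT L M β μ 0 0 klE0 *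
                  hubbardGridSub L M β (2 * (2 * M))) (((p₁, σ.rev), 0) : GridLeg (GridPoint L (2 * (2 * M)))) ((p₀, σ.rev), 1))‖) ≤
        B * (((2 * (2 * M) : ℕ) : ℝ) / β)) :
    ∑ p₁ : GridPoint L (2 * (2 * M)), w p₀ p₁ * ‖kernel ℂ (∑ p' : GridPoint L (2 * (2 * M)), ∑ q' : GridPoint L (2 * (2 * M)), ∑ σ' : Fin 2,
          (if p' = q' then (0 : ℂ) else
            -((((U * (β / (2 * (2 * M) : ℕ)) : ℝ) : ℂ) ^ 2 *
              (contr ℂ ((hubbardGridSub L M β (2 * (2 * M))).transpose * hubbardCovAboveCT L M β μ 0 0 klE0 *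
                  hubbardGridSub L M β (2 * (2 * M))) (((q', σ'), 0) : GridLeg (GridPoint L (2 * (2 * M)))) ((p', σ'), 1) *
                (contr ℂ ((hubbardGridSub L M β (2 * (2 * M))).transpose * hubbardCovAboveCT L M β μ 0 0 klE0 *
                    hubbardGridSub L M β (2 * (2 * M))) (((p', σ'.rev), 0) : GridLeg (GridPoint L (2 * (2 * M)))) ((q', σ'.rev), 1) *
                  contr ℂ ((hubbardGridSub L M β (2 * (2 * M))).transpose * hubbardCovAboveCT L M β μ 0 0 klE0 *
                    hubbardGridSub L M β (2 * (2 * M))) (((q', σ'.rev), 0) : GridLeg (GridPoint L (2 * (2 * M)))) ((p', σ'.rev), 1)))))) •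
            (gen ℂ (((p', σ'), 0) : GridLeg (GridPoint L (2 * (2 * M)))) * gen ℂ (((q', σ'), 1) : GridLeg (GridPoint L (2 * (2 * M))))))
        2 (fun i => ((![p₀, p₁] i, σ), i))‖ ≤ (1 / 2) * B * U ^ 2 * (β / ((2 * (2 * M) : ℕ) : ℝ)) := by
  have hN : (0 : ℝ) < ((2 * (2 * M) : ℕ) : ℝ) := by have := NeZero.ne M; positivity
  rw [sum_weight_norm_kernel_two_sunsetQuadratic_eq]
  have h0 : (0 : ℝ) ≤ (1 / 2) * (U * (β / ((2 * (2 * M) : ℕ) : ℝ))) ^ 2 := by positivity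
  refine (mul_le_mul_of_nonneg_left hB h0).trans (le_of_eq ?_)
  field_simp

/-! ## §4 The position-side element `W_a″ := W₀ − S − Q_c − D_e` has the tail's pinned sums -/

/-- **ANY weighted pinned sum of `‖kernel₂ (W₀ − S − Q_c − D_e)‖` IS that of `‖kernel₂ T₃‖`** (`T₃ = W₀ − e^{Δ}V + ½(e^{Δ}V² − (e^{Δ}V)²)`): the MIXED door's
rows `(a-on)` (`w = [x⃗₁ = x⃗₀]`) and `(a-off)` (`w = [x⃗₁ ≠ x⃗₀](1+|Δx̃₀|+|Δx̃₁|)ᵏ`) for `W_a″` are p1's tail rows verbatim. -/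
theorem sum_weight_norm_kernel_two_scaleZero_sub_sunset_chain_diag_eq (β U μ : ℝ)
    (w : GridPoint L (2 * (2 * M)) → GridPoint L (2 * (2 * M)) → ℝ) (σ : Fin 2) (p₀ : GridPoint L (2 * (2 * M))) :
    ∑ p₁ : GridPoint L (2 * (2 * M)), w p₀ p₁ * ‖kernel ℂ (effAction ℂ ((hubbardGridSub L M β (2 * (2 * M))).transpose * hubbardCovAboveCT L M β μ 0 0 klE0 *
          hubbardGridSub L M β (2 * (2 * M))) (hubbardGridInteraction L (2 * (2 * M)) β U) -
        (∑ p' : GridPoint L (2 * (2 * M)), ∑ q' : GridPoint L (2 * (2 * M)), ∑ σ' : Fin 2,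
          (if p' = q' then (0 : ℂ) else
            -((((U * (β / (2 * (2 * M) : ℕ)) : ℝ) : ℂ) ^ 2 *
              (contr ℂ ((hubbardGridSub L M β (2 * (2 * M))).transpose * hubbardCovAboveCT L M β μ 0 0 klE0 *
                  hubbardGridSub L M β (2 * (2 * M))) (((q', σ'), 0) : GridLeg (GridPoint L (2 * (2 * M)))) ((p', σ'), 1) *
                (contr ℂ ((hubbardGridSub L M β (2 * (2 * M))).transpose * hubbardCovAboveCT L M β μ 0 0 klE0 *
                    hubbardGridSub L M β (2 * (2 * M))) (((p', σ'.rev), 0) : GridLeg (GridPoint L (2 * (2 * M)))) ((q', σ'.rev), 1) *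
                  contr ℂ ((hubbardGridSub L M β (2 * (2 * M))).transpose * hubbardCovAboveCT L M β μ 0 0 klE0 *
                    hubbardGridSub L M β (2 * (2 * M))) (((q', σ'.rev), 0) : GridLeg (GridPoint L (2 * (2 * M)))) ((p', σ'.rev), 1)))))) •
            (gen ℂ (((p', σ'), 0) : GridLeg (GridPoint L (2 * (2 * M)))) * gen ℂ (((q', σ'), 1) : GridLeg (GridPoint L (2 * (2 * M)))))) -
        (∑ p' : GridPoint L (2 * (2 * M)), ∑ q' : GridPoint L (2 * (2 * M)), ∑ σ' : Fin 2,
          ((((U * (β / (2 * (2 * M) : ℕ)) : ℝ) : ℂ) ^ 2 *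
              ((-∑ k : FreqMomentum L M, ((1 / (β * (L : ℝ) ^ 2) : ℝ) : ℂ) ^ 2 * uvSymbolCT L M β μ 0 klE0 (k, 0)) *
               (-∑ k : FreqMomentum L M, ((1 / (β * (L : ℝ) ^ 2) : ℝ) : ℂ) ^ 2 * uvSymbolCT L M β μ 0 klE0 (k, 0)))) *
            contr ℂ ((hubbardGridSub L M β (2 * (2 * M))).transpose * hubbardCovAboveCT L M β μ 0 0 klE0 *
              hubbardGridSub L M β (2 * (2 * M))) (((q', σ'), 0) : GridLeg (GridPoint L (2 * (2 * M)))) ((p', σ'), 1)) •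
            (gen ℂ (((p', σ'), 0) : GridLeg (GridPoint L (2 * (2 * M)))) * gen ℂ (((q', σ'), 1) : GridLeg (GridPoint L (2 * (2 * M)))))) -
        (∑ p' : GridPoint L (2 * (2 * M)), ∑ σ' : Fin 2,
          ((2 : ℂ) * ((2 : ℂ)⁻¹ * (((U * (β / (2 * (2 * M) : ℕ)) : ℝ) : ℂ) *
              (-∑ k : FreqMomentum L M, ((1 / (β * (L : ℝ) ^ 2) : ℝ) : ℂ) ^ 2 * uvSymbolCT L M β μ 0 klE0 (k, 0))) +
            (2 : ℂ)⁻¹ * (((U * (β / (2 * (2 * M) : ℕ)) : ℝ) : ℂ) ^ 2 *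
              ((-∑ k : FreqMomentum L M, ((1 / (β * (L : ℝ) ^ 2) : ℝ) : ℂ) ^ 2 * uvSymbolCT L M β μ 0 klE0 (k, 0)) *
                ∑ q : GridPoint L (2 * (2 * M)),
                  contr ℂ ((hubbardGridSub L M β (2 * (2 * M))).transpose * hubbardCovAboveCT L M β μ 0 0 klE0 *
                      hubbardGridSub L M β (2 * (2 * M))) (((p', σ'.rev), 0) : GridLeg (GridPoint L (2 * (2 * M)))) ((q, σ'.rev), 1) *
                    contr ℂ ((hubbardGridSub L M β (2 * (2 * M))).transpose * hubbardCovAboveCT L M β μ 0 0 klE0 *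
                      hubbardGridSub L M β (2 * (2 * M))) (((q, σ'.rev), 0) : GridLeg (GridPoint L (2 * (2 * M)))) ((p', σ'.rev), 1))) -
            (2 : ℂ)⁻¹ * ((((U * (β / (2 * (2 * M) : ℕ)) : ℝ) : ℂ) ^ 2 *
                ((-∑ k : FreqMomentum L M, ((1 / (β * (L : ℝ) ^ 2) : ℝ) : ℂ) ^ 2 * uvSymbolCT L M β μ 0 klE0 (k, 0)) *
                 (-∑ k : FreqMomentum L M, ((1 / (β * (L : ℝ) ^ 2) : ℝ) : ℂ) ^ 2 * uvSymbolCT L M β μ 0 klE0 (k, 0)))) *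
              (-∑ k : FreqMomentum L M, ((1 / (β * (L : ℝ) ^ 2) : ℝ) : ℂ) ^ 2 * uvSymbolCT L M β μ 0 klE0 (k, 0))))) •
            (gen ℂ (((p', σ'), 0) : GridLeg (GridPoint L (2 * (2 * M)))) * gen ℂ (((p', σ'), 1) : GridLeg (GridPoint L (2 * (2 * M))))))) 2
        (fun i => ((![p₀, p₁] i, σ), i))‖ =
    ∑ p₁ : GridPoint L (2 * (2 * M)), w p₀ p₁ * ‖kernel ℂ (effAction ℂ ((hubbardGridSub L M β (2 * (2 * M))).transpose * hubbardCovAboveCT L M β μ 0 0 klE0 *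
            hubbardGridSub L M β (2 * (2 * M))) (hubbardGridInteraction L (2 * (2 * M)) β U) -
          gaussConv ℂ ((hubbardGridSub L M β (2 * (2 * M))).transpose * hubbardCovAboveCT L M β μ 0 0 klE0 *
            hubbardGridSub L M β (2 * (2 * M))) (hubbardGridInteraction L (2 * (2 * M)) β U) +
        (2 : ℂ)⁻¹ • (gaussConv ℂ ((hubbardGridSub L M β (2 * (2 * M))).transpose * hubbardCovAboveCT L M β μ 0 0 klE0 *
              hubbardGridSub L M β (2 * (2 * M))) (hubbardGridInteraction L (2 * (2 * M)) β U * hubbardGridInteraction L (2 * (2 * M)) β U) -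
          gaussConv ℂ ((hubbardGridSub L M β (2 * (2 * M))).transpose * hubbardCovAboveCT L M β μ 0 0 klE0 *
              hubbardGridSub L M β (2 * (2 * M))) (hubbardGridInteraction L (2 * (2 * M)) β U) *
            gaussConv ℂ ((hubbardGridSub L M β (2 * (2 * M))).transpose * hubbardCovAboveCT L M β μ 0 0 klE0 *
              hubbardGridSub L M β (2 * (2 * M))) (hubbardGridInteraction L (2 * (2 * M)) β U))) 2
        (fun i => ((![p₀, p₁] i, σ), i))‖ := by
  refine Finset.sum_congr rfl fun p₁ _ => ?_
  rw [kernel_two_scaleZero_effAction_sub_sunset_chain_diag β U μ p₀ p₁ σ]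

end Split

end Summit.HubbardSuperconductivity.HubbardSuperconductivity.Theorems.KLRegimeSplit

end
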